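import Summits.AtomisticToContinuum.HydrodynamicLimit.Theorems.ImplosionDichotomyPolynomialCompressionLevel0Shadowing
import Summits.AtomisticToContinuum.HydrodynamicLimit.Theorems.ImplosionDichotomyPolynomialCompressionShadowingDefs
import Summits.AtomisticToContinuum.HydrodynamicLimit.Theorems.ImplosionDichotomyPolynomialCompressionSolutionAPI

/-!
# The level-0 contract of the shadowing estimate (line `log-lipschitz-budget`, stub 4)

Helper file for the line `log-lipschitz-budget` of the crux
`ImplosionDichotomy.PolynomialCompression` (stmt-AtomisticToContinuum-12587), stub
`stub_logBudgetShadowing`, blueprint §3/§5: the **level-0 contract `L0`**, i.e. the level-0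
(`L²`) shadowing estimate `level0_shadowing` normalised into the shape consumed by the closing
bootstrap argument. In the common setting `ShadowSetting` (σ-solution `(ρ, u, θ)` with law
`ρ θ ζ(ρ)`, isentropic Type-I ideal-gas reference `(ρ₁, u₁, θ₁)` with polynomial envelopes
`Cpoly n (T₁ - t)^{-ppoly n}` and no-vacuum floor `c_l (T₁ - t)^{p_l}`, data `u(0) = u₁(0)`,
`θ(0) = θ₁(0)`, `‖δρ(0)‖_{C⁶} ≤ Cstat · σ³`) and in the weak bootstrap regime
`ShadowWeakBootstrap` on `[0, t₀]`, `t₀ ∈ [0, T)`, the level-0 energy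
`E₀ = shadowE0 ζ ρ θ u ρ₁ θ₁ u₁` obeys `√E₀(s) ≤ σ³ Q (T₁/(T₁ - s))^b` on `[0, t₀]`
(`ShadowLevelBound`), with `Q, b ≥ 0` depending only on the constants.

* `sqrt_shadowE0_zero_le` — initial smallness `√E₀(0) ≤ σ³ Cstat(0) √((5/4) K (c_l T₁^{p_l})^{-1/3})`
  (`δu(0) = 0`, `δθ(0) = 0`, `A(0) ≤ (5/2) K ρ₁(0)^{-1/3}`, `|δρ(0)| ≤ Cstat(0) σ³`);
* `level0_envelope_le`, `level0_forcing_integral_le` — with the envelope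
  `P(s) = (Cpoly 0 (T₁ - s)^{-ppoly 0})^{1/3} ≥ ρ₁^{1/3}`, the forcing integral
  `½∫₀ᵗ Γσ³(1 + P)⁸/(T₁ - s) ds` is `≤ σ³ Γ' (T₁/(T₁ - t))^{b'}` with explicit `Γ', b'`;
* `continuousOn_shadowE0_of_solutions` — `E₀` is continuous on `[0, T)`;
* `level0_contract` — `level0_shadowing` on the solutions restricted to `[0, s)`
  (`isHardSphereEulerSolution_restrict`), the three items above, `T₁/(T₁ - s) ≥ 1`, and the left
  limit `t → s⁻` (`ContinuousWithinAt.closure_le`); `Q = Q_init + Γ'`, `b = Λ/2 + b'`.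
-/

noncomputable section

namespace Summit.AtomisticToContinuum.HydrodynamicLimit.Theorems

open Set Filter Topology MeasureTheory
open scoped ContDiff
open Literature.MathematicalPhysics.KineticTheory Literature.Analysis.FunctionSpaces

section Level0Contract

/-! ### The level-0 contract: normalisation of the level-0 shadowing estimate -/

/-- Negative powers against the horizon: `a^{-q} = T₁^{-q} (T₁/a)^q` for `a, T₁ > 0`. [folklore] -/
theorem rpow_neg_eq_rpow_neg_mul_div_rpow {a M : ℝ} (q : ℝ) (ha : 0 < a) (hM : 0 < M) :
    a ^ (-q) = M ^ (-q) * (M / a) ^ q := by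
  rw [Real.div_rpow hM.le ha.le, Real.rpow_neg hM.le, Real.rpow_neg ha.le]
  have h1 : 0 < M ^ q := Real.rpow_pos_of_pos hM q
  field_simp

/-- The polynomial envelope along `[0, t]`: for `0 ≤ s ≤ t < T₁` and `c ≥ 0`,
`(c (T₁ - s)^{-p})^{1/3} ≤ (c T₁^{-p})^{1/3} (T₁/(T₁ - t))^{|p|/3}`. [folklore] -/
theorem level0_envelope_le {c p T₁ s t : ℝ} (hc : 0 ≤ c) (hT₁ : 0 < T₁) (hs : 0 ≤ s)
    (hst : s ≤ t) (ht : t < T₁) :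
    (c * (T₁ - s) ^ (-p)) ^ (1 / 3 : ℝ) ≤
      (c * T₁ ^ (-p)) ^ (1 / 3 : ℝ) * (T₁ / (T₁ - t)) ^ (|p| / 3) := by
  have hTs : 0 < T₁ - s := by linarith
  have hTt : 0 < T₁ - t := by linarith
  have hY1 : 1 ≤ T₁ / (T₁ - s) := by rw [le_div_iff₀ hTs]; linarith
  have hYX : T₁ / (T₁ - s) ≤ T₁ / (T₁ - t) := div_le_div_of_nonneg_left hT₁.le hTt (by linarith)
  have hX0 : 0 ≤ T₁ / (T₁ - t) := by positivity
  have h1 : (T₁ - s) ^ (-p) ≤ T₁ ^ (-p) * (T₁ / (T₁ - t)) ^ |p| := by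
    rw [rpow_neg_eq_rpow_neg_mul_div_rpow p hTs hT₁]
    refine mul_le_mul_of_nonneg_left ?_ (Real.rpow_nonneg hT₁.le _)
    exact (Real.rpow_le_rpow_of_exponent_le hY1 (le_abs_self p)).trans
      (Real.rpow_le_rpow (zero_le_one.trans hY1) hYX (abs_nonneg p))
  have h2 : c * (T₁ - s) ^ (-p) ≤ c * T₁ ^ (-p) * (T₁ / (T₁ - t)) ^ |p| := by
    rw [mul_assoc]; exact mul_le_mul_of_nonneg_left h1 hc
  calc (c * (T₁ - s) ^ (-p)) ^ (1 / 3 : ℝ)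
      ≤ (c * T₁ ^ (-p) * (T₁ / (T₁ - t)) ^ |p|) ^ (1 / 3 : ℝ) :=
        Real.rpow_le_rpow (mul_nonneg hc (Real.rpow_nonneg hTs.le _)) h2 (by norm_num)
    _ = (c * T₁ ^ (-p)) ^ (1 / 3 : ℝ) * (T₁ / (T₁ - t)) ^ (|p| / 3) := by
        rw [Real.mul_rpow (mul_nonneg hc (Real.rpow_nonneg hT₁.le _)) (Real.rpow_nonneg hX0 _),
          ← Real.rpow_mul hX0, show |p| * (1 / 3 : ℝ) = |p| / 3 by ring]

/-- The forcing integral of the level-0 estimate with the polynomial envelope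
`P(s) = (c (T₁ - s)^{-p})^{1/3}` is of normalised form:
`½ ∫₀ᵗ Γ σ³ (1 + P)⁸/(T₁ - s) ds ≤ σ³ · ½Γ(1 + (cT₁^{-p})^{1/3})⁸ · (T₁/(T₁ - t))^{8|p|/3 + 1}`
for `0 ≤ t < T₁` (sup of the integrand times `t ≤ T₁`). [folklore] -/
theorem level0_forcing_integral_le {Γ σ c p T₁ t : ℝ} (hΓ : 0 ≤ Γ) (hσ : 0 ≤ σ) (hc : 0 ≤ c)
    (hT₁ : 0 < T₁) (ht0 : 0 ≤ t) (ht : t < T₁) :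
    (∫ s in (0 : ℝ)..t, Γ * σ ^ 3 * (1 + (c * (T₁ - s) ^ (-p)) ^ (1 / 3 : ℝ)) ^ 8 / (T₁ - s)) / 2 ≤
      σ ^ 3 * (Γ * (1 + (c * T₁ ^ (-p)) ^ (1 / 3 : ℝ)) ^ 8 / 2) *
        (T₁ / (T₁ - t)) ^ (8 * |p| / 3 + 1) := by
  set c₀ : ℝ := (c * T₁ ^ (-p)) ^ (1 / 3 : ℝ) with hc₀
  set X : ℝ := T₁ / (T₁ - t) with hX
  have hTt : 0 < T₁ - t := by linarith
  have hTt' : T₁ - t ≠ 0 := hTt.ne'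
  have hXpos : 0 < X := div_pos hT₁ hTt
  have hX1 : 1 ≤ X := by rw [hX, le_div_iff₀ hTt]; linarith
  have hc₀0 : 0 ≤ c₀ := Real.rpow_nonneg (mul_nonneg hc (Real.rpow_nonneg hT₁.le _)) _
  -- the constant bound of the integrand on `(0, t]`
  set M : ℝ := Γ * σ ^ 3 * ((1 + c₀) * X ^ (|p| / 3)) ^ 8 / (T₁ - t) with hM
  have hM0 : 0 ≤ M := by positivity
  have hbound : ∀ s ∈ Set.uIoc (0 : ℝ) t,
      ‖Γ * σ ^ 3 * (1 + (c * (T₁ - s) ^ (-p)) ^ (1 / 3 : ℝ)) ^ 8 / (T₁ - s)‖ ≤ M := by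
    intro s hs
    rw [uIoc_of_le ht0] at hs
    have hs0 : 0 ≤ s := hs.1.le
    have hTs : 0 < T₁ - s := by linarith [hs.2]
    have hP0 : 0 ≤ (c * (T₁ - s) ^ (-p)) ^ (1 / 3 : ℝ) :=
      Real.rpow_nonneg (mul_nonneg hc (Real.rpow_nonneg hTs.le _)) _
    have hPle : (c * (T₁ - s) ^ (-p)) ^ (1 / 3 : ℝ) ≤ c₀ * X ^ (|p| / 3) :=
      level0_envelope_le hc hT₁ hs0 hs.2 ht
    have hX1' : 1 ≤ X ^ (|p| / 3) := Real.one_le_rpow hX1 (by positivity)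
    have h1 : 1 + (c * (T₁ - s) ^ (-p)) ^ (1 / 3 : ℝ) ≤ (1 + c₀) * X ^ (|p| / 3) := by nlinarith
    have h2 : (1 + (c * (T₁ - s) ^ (-p)) ^ (1 / 3 : ℝ)) ^ 8 ≤ ((1 + c₀) * X ^ (|p| / 3)) ^ 8 :=
      pow_le_pow_left₀ (by positivity) h1 8
    rw [Real.norm_of_nonneg (by positivity)]
    exact div_le_div₀ (by positivity) (mul_le_mul_of_nonneg_left h2 (by positivity)) hTt
      (by linarith [hs.2])
  have hint := intervalIntegral.norm_integral_le_of_norm_le_const hbound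
  rw [sub_zero, abs_of_nonneg ht0, Real.norm_eq_abs] at hint
  have hint' : (∫ s in (0 : ℝ)..t,
      Γ * σ ^ 3 * (1 + (c * (T₁ - s) ^ (-p)) ^ (1 / 3 : ℝ)) ^ 8 / (T₁ - s)) ≤ M * T₁ :=
    ((le_abs_self _).trans hint).trans (mul_le_mul_of_nonneg_left ht.le hM0)
  have hexp : M * T₁ = Γ * σ ^ 3 * (((1 + c₀) * X ^ (|p| / 3)) ^ 8 * X) := by
    rw [hM, hX]
    field_simp
  have hpow : ((1 + c₀) * X ^ (|p| / 3)) ^ 8 * X = (1 + c₀) ^ 8 * X ^ (8 * |p| / 3 + 1) := by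
    rw [mul_pow, Real.rpow_add hXpos, Real.rpow_one,
      show (8 * |p| / 3 : ℝ) = |p| / 3 * ((8 : ℕ) : ℝ) by push_cast; ring,
      Real.rpow_mul hXpos.le, Real.rpow_natCast]
    ring
  calc (∫ s in (0 : ℝ)..t,
      Γ * σ ^ 3 * (1 + (c * (T₁ - s) ^ (-p)) ^ (1 / 3 : ℝ)) ^ 8 / (T₁ - s)) / 2 ≤ M * T₁ / 2 := by
        linarith
    _ = σ ^ 3 * (Γ * (1 + c₀) ^ 8 / 2) * X ^ (8 * |p| / 3 + 1) := by
        rw [hexp, hpow]; ring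

/-- **Initial smallness of the level-0 energy.** At `t = 0` the velocity and temperature data agree,
`|δρ(0)| ≤ M σ³` in sup norm, and in the weak bootstrap regime the weight obeys
`A(0) ≤ (5/2) K ρ₁(0)^{-1/3} ≤ (5/2) K (c_l T₁^{p_l})^{-1/3}`; hence
`√E₀(0) ≤ σ³ M √((5/4) K (c_l T₁^{p_l})^{-1/3})`. [folklore] -/
theorem sqrt_shadowE0_zero_le {K cZ T₁ cl pl σ M : ℝ} {ρ θ ρ₁ θ₁ : ℝ → T3 → ℝ}
    {u u₁ : ℝ → T3 → V3} {ζ : ℝ → ℝ} (hK : 0 < K) (hcZ : 0 ≤ cZ) (hT₁ : 0 < T₁) (hcl : 0 < cl)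
    (hσ : 0 ≤ σ) (hM : 0 ≤ M) (hρ : ∀ x, 0 < ρ 0 x) (hρ₁ : ∀ x, 0 < ρ₁ 0 x)
    (hEos : ∀ x, |ζ (ρ 0 x) - 1| ≤ cZ * (ρ 0 x * σ ^ 3) ∧
      |ρ 0 x * deriv ζ (ρ 0 x)| ≤ cZ * (ρ 0 x * σ ^ 3) ∧
      |ρ 0 x ^ 2 * deriv (deriv ζ) (ρ 0 x)| ≤ cZ * (ρ 0 x * σ ^ 3))
    (hIsen : ∀ x, θ₁ 0 x = K * ρ₁ 0 x ^ (2 / 3 : ℝ)) (hfloor : ∀ x, cl * T₁ ^ pl ≤ ρ₁ 0 x)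
    (hu0 : u 0 = u₁ 0) (hθ0 : θ 0 = θ₁ 0)
    (hstat : ∀ y, ‖iteratedFDeriv ℝ 0 (Torus.lift (fun x => ρ 0 x - ρ₁ 0 x)) y‖ ≤ M * σ ^ 3)
    (hB0 : ∀ x, |ρ 0 x - ρ₁ 0 x| ≤ ρ₁ 0 x / 2 ∧ |θ 0 x - θ₁ 0 x| ≤ θ₁ 0 x / 2 ∧
      ρ 0 x * σ ^ 3 ≤ 1 / (8 * (cZ + 1))) :
    Real.sqrt (shadowE0 ζ ρ θ u ρ₁ θ₁ u₁ 0) ≤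
      σ ^ 3 * (M * Real.sqrt (5 / 2 * K * (cl * T₁ ^ pl) ^ (-(1 / 3 : ℝ)) / 2)) := by
  set Am : ℝ := 5 / 2 * K * (cl * T₁ ^ pl) ^ (-(1 / 3 : ℝ)) with hAm
  have hm0 : 0 < cl * T₁ ^ pl := mul_pos hcl (Real.rpow_pos_of_pos hT₁ _)
  have hAm0 : 0 ≤ Am := by positivity
  -- pointwise bound of the integrand at time `0`
  have hpt : ∀ x, 0 ≤ 1 / 2 * (shadowWeightA ζ ρ θ 0 x * (ρ 0 x - ρ₁ 0 x) ^ 2 +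
      ρ 0 x * ‖u 0 x - u₁ 0 x‖ ^ 2 + shadowWeightB ρ θ 0 x * (θ 0 x - θ₁ 0 x) ^ 2) ∧
      1 / 2 * (shadowWeightA ζ ρ θ 0 x * (ρ 0 x - ρ₁ 0 x) ^ 2 +
      ρ 0 x * ‖u 0 x - u₁ 0 x‖ ^ 2 + shadowWeightB ρ θ 0 x * (θ 0 x - θ₁ 0 x) ^ 2) ≤
      1 / 2 * (Am * (M * σ ^ 3) ^ 2) := by
    intro x
    have hux : u 0 x = u₁ 0 x := by rw [hu0]
    have hθx : θ 0 x = θ₁ 0 x := by rw [hθ0]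
    have hρx := hρ x
    have hρ₁x := hρ₁ x
    have hρ₁ne : ρ₁ 0 x ≠ 0 := hρ₁x.ne'
    obtain ⟨hb1, -, hb3⟩ := hB0 x
    obtain ⟨he1, he2, -⟩ := hEos x
    have hη : 0 ≤ ρ 0 x * σ ^ 3 := by positivity
    have hpack : cZ * (ρ 0 x * σ ^ 3) ≤ 1 / 8 := by
      have h8 : ρ 0 x * σ ^ 3 * (8 * (cZ + 1)) ≤ 1 := by
        have h := hb3
        rwa [le_div_iff₀ (by positivity)] at h
      nlinarith
    rw [abs_le] at he1 he2 hb1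
    have hγpos : 0 < ζ (ρ 0 x) + ρ 0 x * deriv ζ (ρ 0 x) := by linarith [he1.1, he2.1]
    have hγle : ζ (ρ 0 x) + ρ 0 x * deriv ζ (ρ 0 x) ≤ 5 / 4 := by linarith [he1.2, he2.2]
    have hρlow : ρ₁ 0 x / 2 ≤ ρ 0 x := by linarith [hb1.1]
    have hθ₁pos : 0 < θ₁ 0 x := by rw [hIsen x]; positivity
    -- the weight `A` at time `0`
    have hA0 : 0 ≤ shadowWeightA ζ ρ θ 0 x := by
      simp only [shadowWeightA]
      rw [hθx]
      positivity
    have hAle : shadowWeightA ζ ρ θ 0 x ≤ Am := by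
      simp only [shadowWeightA]
      rw [hθx]
      calc θ₁ 0 x * (ζ (ρ 0 x) + ρ 0 x * deriv ζ (ρ 0 x)) / ρ 0 x
          ≤ θ₁ 0 x * (ζ (ρ 0 x) + ρ 0 x * deriv ζ (ρ 0 x)) / (ρ₁ 0 x / 2) :=
            div_le_div_of_nonneg_left (by positivity) (by positivity) hρlow
        _ ≤ θ₁ 0 x * (5 / 4) / (ρ₁ 0 x / 2) := by gcongr
        _ = 5 / 2 * K * ρ₁ 0 x ^ (-(1 / 3 : ℝ)) := by
            rw [hIsen x, show (-(1 / 3 : ℝ)) = 2 / 3 - 1 by norm_num,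
              Real.rpow_sub_one hρ₁ne]
            field_simp
            ring
        _ ≤ Am := by
            have h := Real.rpow_le_rpow_of_nonpos hm0 (hfloor x)
              (by norm_num : (-(1 / 3 : ℝ)) ≤ 0)
            rw [hAm]
            exact mul_le_mul_of_nonneg_left h (by positivity)
    -- the sup bound of `δρ(0)`
    have hd : (ρ 0 x - ρ₁ 0 x) ^ 2 ≤ (M * σ ^ 3) ^ 2 := by
      have h := hstat (Torus.repr x)
      rw [norm_iteratedFDeriv_zero, Torus.lift_repr, Real.norm_eq_abs] at h
      exact sq_le_sq' (abs_le.1 h).1 (abs_le.1 h).2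
    have hu' : ‖u 0 x - u₁ 0 x‖ ^ 2 = 0 := by rw [hux, sub_self, norm_zero]; norm_num
    have hθ' : (θ 0 x - θ₁ 0 x) ^ 2 = 0 := by rw [hθx, sub_self]; norm_num
    rw [hu', hθ', mul_zero, mul_zero, add_zero, add_zero]
    constructor
    · positivity
    · have h := mul_le_mul hAle hd (sq_nonneg _) hAm0
      linarith
  -- integrate over the probability space `𝕋³`
  have hint : shadowE0 ζ ρ θ u ρ₁ θ₁ u₁ 0 ≤ 1 / 2 * (Am * (M * σ ^ 3) ^ 2) := by
    have h := norm_integral_le_of_norm_le_const (μ := (volume : Measure T3))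
      (f := fun x => 1 / 2 * (shadowWeightA ζ ρ θ 0 x * (ρ 0 x - ρ₁ 0 x) ^ 2 +
        ρ 0 x * ‖u 0 x - u₁ 0 x‖ ^ 2 + shadowWeightB ρ θ 0 x * (θ 0 x - θ₁ 0 x) ^ 2))
      (C := 1 / 2 * (Am * (M * σ ^ 3) ^ 2))
      (Eventually.of_forall fun x => by
        rw [Real.norm_of_nonneg (hpt x).1]
        exact (hpt x).2)
    rw [probReal_univ, mul_one, Real.norm_eq_abs] at h
    unfold shadowE0
    exact (le_abs_self _).trans h
  rw [Real.sqrt_le_left (by positivity)]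
  calc shadowE0 ζ ρ θ u ρ₁ θ₁ u₁ 0 ≤ 1 / 2 * (Am * (M * σ ^ 3) ^ 2) := hint
    _ = (σ ^ 3 * (M * Real.sqrt (Am / 2))) ^ 2 := by
        have hs : Real.sqrt (Am / 2) ^ 2 = Am / 2 := Real.sq_sqrt (by positivity)
        linear_combination (-(σ ^ 3) ^ 2 * M ^ 2) * hs

/-- `s ↦ shadowE0 … s` is continuous on `[0, T)` for two classical solutions (joint smoothness
of the integrand, `Torus.IsSmoothSpaceTimeOn.continuousOn_integral`). [folklore] -/
theorem continuousOn_shadowE0_of_solutions {σ σ₁ T : ℝ} {ρ θ ρ₁ θ₁ : ℝ → T3 → ℝ}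
    {u u₁ : ℝ → T3 → V3} {ζ : ℝ → ℝ} {J : Set ℝ} (hE : IsHardSphereEulerSolution σ T ρ u θ)
    (hE₁ : IsHardSphereEulerSolution σ₁ T ρ₁ u₁ θ₁) (hJ : IsOpen J)
    (hζ : ContDiffOn ℝ (⊤ : ℕ∞) ζ J) (hρJ : ∀ t ∈ Ico 0 T, ∀ x, ρ t x ∈ J) :
    ContinuousOn (shadowE0 ζ ρ θ u ρ₁ θ₁ u₁) (Ico 0 T) := by
  have hA := isSmoothSpaceTimeOn_weightA hE hJ hζ hρJ
  have hB := isSmoothSpaceTimeOn_weightB hE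
  have hα := hE.smooth_density.sub hE₁.smooth_density
  have hw := hE.smooth_velocity.sub hE₁.smooth_velocity
  have hβ := hE.smooth_temperature.sub hE₁.smooth_temperature
  have he : Torus.IsSmoothSpaceTimeOn (Ico 0 T) (fun s x => 1 / 2 *
      (shadowWeightA ζ ρ θ s x * (ρ s x - ρ₁ s x) ^ 2 + ρ s x * ‖u s x - u₁ s x‖ ^ 2 +
        shadowWeightB ρ θ s x * (θ s x - θ₁ s x) ^ 2)) := by
    have h := ((hA.mul (hα.mul hα)).add (hE.smooth_density.mul (hw.inner hw))).add
      (hB.mul (hβ.mul hβ))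
    refine ContDiffOn.congr (h.const_smul (1 / 2 : ℝ)) ?_
    rintro ⟨s, y⟩ _
    simp only [Torus.stLift_apply, smul_eq_mul, real_inner_self_eq_norm_sq, shadowWeightA,
      shadowWeightB]
    ring
  exact he.continuousOn_integral (convex_Ico _ _)

/-- **Level-0 contract `L0`** (line `log-lipschitz-budget`, stub 4, base of the induction of the
close): in the common setting `ShadowSetting` and the weak bootstrap regime on `[0, t₀]`,
`t₀ ∈ [0, T)`, the level-0 energy obeys the normalised bound
`√E₀(s) ≤ σ³ Q (T₁/(T₁ - s))^b` on `[0, t₀]`, with `Q, b ≥ 0` depending only on the constants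
`K, C, C_b, c_Z, T₁, c_l, p_l, Cpoly, ppoly, Cstat`. Proof: `level0_shadowing` on the restricted
solutions on `[0, s)` with the envelope `P = (Cpoly 0 (T₁ - ·)^{-ppoly 0})^{1/3} ≥ ρ₁^{1/3}`,
the initial smallness `√E₀(0) ≤ σ³ Q_init` (`sqrt_shadowE0_zero_le`), the forcing bound
`level0_forcing_integral_le`, `T₁/(T₁ - s) ≥ 1`, and the left limit `t → s⁻` by continuity of
`E₀`. [folklore] -/
theorem level0_contract :
    ∀ (K C Cb cZ T₁ cl pl : ℝ) (Cpoly ppoly Cstat : ℕ → ℝ), 0 < K → 0 ≤ C → 0 ≤ Cb → 0 ≤ cZ →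
      0 < T₁ → 0 < cl → (∀ n, 0 ≤ Cpoly n) → (∀ n, 0 ≤ Cstat n) →
      ∃ Q b : ℝ, 0 ≤ Q ∧ 0 ≤ b ∧
        ∀ (σ T t₀ : ℝ) (ρ θ ρ₁ θ₁ : ℝ → T3 → ℝ) (u u₁ : ℝ → T3 → V3) (ζ : ℝ → ℝ) (J : Set ℝ),
          ShadowSetting K C cZ T₁ cl pl Cpoly ppoly Cstat σ T ρ θ ρ₁ θ₁ u u₁ ζ J →
          t₀ ∈ Ico 0 T → ShadowWeakBootstrap Cb (1 / (8 * (cZ + 1))) T₁ σ ρ θ u ρ₁ θ₁ u₁ t₀ →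
          ShadowLevelBound (shadowE0 ζ ρ θ u ρ₁ θ₁ u₁) Q b T₁ σ t₀ := by
  intro K C Cb cZ T₁ cl pl Cpoly ppoly Cstat hK hC hCb hcZ hT₁ hcl hCpoly hCstat
  obtain ⟨Λ, Γ, hΛ, hΓ, H⟩ := level0_shadowing K C Cb cZ hK hC hCb hcZ
  -- the constants
  set Qi : ℝ := Cstat 0 * Real.sqrt (5 / 2 * K * (cl * T₁ ^ pl) ^ (-(1 / 3 : ℝ)) / 2) with hQi
  set c₀ : ℝ := (Cpoly 0 * T₁ ^ (-ppoly 0)) ^ (1 / 3 : ℝ) with hc₀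
  set Γ' : ℝ := Γ * (1 + c₀) ^ 8 / 2 with hΓ'
  set b' : ℝ := 8 * |ppoly 0| / 3 + 1 with hb'
  have hQi0 : 0 ≤ Qi := mul_nonneg (hCstat 0) (Real.sqrt_nonneg _)
  have hc₀0 : 0 ≤ c₀ := Real.rpow_nonneg (mul_nonneg (hCpoly 0) (Real.rpow_nonneg hT₁.le _)) _
  have hΓ'0 : 0 ≤ Γ' := by positivity
  have hb'0 : 0 ≤ b' := by positivity
  refine ⟨Qi + Γ', Λ / 2 + b', add_nonneg hQi0 hΓ'0, by positivity, ?_⟩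
  intro σ T t₀ ρ θ ρ₁ θ₁ u u₁ ζ J hS ht₀ hB
  obtain ⟨hE, hE₁, hσ, -, hT, hTT₁, hJ, hζ, hρJ, hp, hEos, hIsen, hTI, hpoly, hfloor, hu0, hθ0,
    hstat⟩ := hS
  obtain ⟨hB0, hB1⟩ := hB
  have h0T : (0 : ℝ) ∈ Ico 0 T := ⟨le_rfl, hT⟩
  have h0t₀ : (0 : ℝ) ∈ Icc 0 t₀ := ⟨le_rfl, ht₀.1⟩
  have hσ3 : 0 ≤ σ ^ 3 := by positivity
  -- the initial bound
  have hinit : Real.sqrt (shadowE0 ζ ρ θ u ρ₁ θ₁ u₁ 0) ≤ σ ^ 3 * Qi :=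
    sqrt_shadowE0_zero_le hK hcZ hT₁ hcl hσ.le (hCstat 0) (fun x => hE.density_pos 0 h0T x)
      (fun x => hE₁.density_pos 0 h0T x) (fun x => hEos 0 h0T x) (fun x => hIsen 0 h0T x)
      (fun x => by simpa only [sub_zero] using hfloor 0 h0T x) hu0 hθ0
      (fun y => hstat 0 (by norm_num) y) (fun x => hB0 0 h0t₀ x)
  intro s hs
  have hsT : s < T := lt_of_le_of_lt hs.2 ht₀.2
  have hsT₁ : s < T₁ := hsT.trans_le hTT₁
  have hX1 : 1 ≤ T₁ / (T₁ - s) := by rw [le_div_iff₀ (sub_pos.2 hsT₁)]; linarith [hs.1]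
  rcases hs.1.eq_or_lt with h0s | hs0
  · -- `s = 0`: the initial bound
    subst h0s
    have h1 : 1 ≤ (T₁ / (T₁ - 0)) ^ (Λ / 2 + b') := Real.one_le_rpow hX1 (by positivity)
    calc Real.sqrt (shadowE0 ζ ρ θ u ρ₁ θ₁ u₁ 0) ≤ σ ^ 3 * Qi := hinit
      _ ≤ σ ^ 3 * (Qi + Γ') * 1 := by nlinarith
      _ ≤ σ ^ 3 * (Qi + Γ') * (T₁ / (T₁ - 0)) ^ (Λ / 2 + b') :=
          mul_le_mul_of_nonneg_left h1 (by positivity)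
  · -- `0 < s ≤ t₀ < T`: restrict to `[0, s)` and pass to the limit `t → s⁻`
    have hsub : Ico 0 s ⊆ Ico 0 T := Ico_subset_Ico_right hsT.le
    have hsub' : Ico 0 s ⊆ Icc 0 t₀ := fun t ht => ⟨ht.1, ht.2.le.trans hs.2⟩
    have hE' : IsHardSphereEulerSolution σ s ρ u θ := isHardSphereEulerSolution_restrict hE hsT.le
    have hE₁' : IsHardSphereEulerSolution 0 s ρ₁ u₁ θ₁ :=
      isHardSphereEulerSolution_restrict hE₁ hsT.le
    -- the envelope `P`
    have hPc : ContinuousOn (fun t => (Cpoly 0 * (T₁ - t) ^ (-ppoly 0)) ^ (1 / 3 : ℝ))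
        (Ico 0 s) := by
      refine ContinuousOn.rpow_const ?_ fun t _ => Or.inr (by norm_num)
      refine continuousOn_const.mul (ContinuousOn.rpow_const ?_ fun t ht => Or.inl ?_)
      · exact continuousOn_const.sub continuousOn_id
      · exact (sub_pos.2 (ht.2.trans hsT₁)).ne'
    have hPle : ∀ t ∈ Ico 0 s, ∀ x, ρ₁ t x ^ (1 / 3 : ℝ) ≤
        (Cpoly 0 * (T₁ - t) ^ (-ppoly 0)) ^ (1 / 3 : ℝ) := by
      intro t ht x
      refine Real.rpow_le_rpow (hE₁.density_pos t (hsub ht) x).le ?_ (by norm_num)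
      have h := (hpoly 0 (by norm_num) t (hsub ht) (Torus.repr x)).1
      rw [norm_iteratedFDeriv_zero, Torus.lift_repr, Real.norm_eq_abs] at h
      exact (le_abs_self _).trans h
    have hB0' : ∀ t ∈ Ico 0 s, ∀ x, |ρ t x - ρ₁ t x| ≤ ρ₁ t x / 2 ∧
        |θ t x - θ₁ t x| ≤ θ₁ t x / 2 ∧ ρ t x * σ ^ 3 * (cZ + 1) ≤ 1 / 8 := by
      intro t ht x
      obtain ⟨h1, h2, h3⟩ := hB0 t (hsub' ht) x
      refine ⟨h1, h2, ?_⟩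
      rw [le_div_iff₀ (by positivity)] at h3
      linarith
    have key := H hE' hE₁' hσ hs0 hsT₁.le hJ hζ (fun t ht x => hρJ t (hsub ht) x)
      (fun t ht x => hp t (hsub ht) x) (fun t ht x => hEos t (hsub ht) x)
      (fun t ht x => hIsen t (hsub ht) x) (fun t ht x i => hTI t (hsub ht) x i) hPc hPle hB0'
      (fun t ht x i => hB1 t (hsub' ht) x i)
    -- the normalised bound on `[0, s)`
    have hbound : ∀ t ∈ Ico 0 s, Real.sqrt (shadowE0 ζ ρ θ u ρ₁ θ₁ u₁ t) ≤
        σ ^ 3 * (Qi + Γ') * (T₁ / (T₁ - t)) ^ (Λ / 2 + b') := by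
      intro t ht
      have htT₁ : t < T₁ := ht.2.trans hsT₁
      have hXt : 0 < T₁ / (T₁ - t) := div_pos hT₁ (sub_pos.2 htT₁)
      have hXt1 : 1 ≤ T₁ / (T₁ - t) := by rw [le_div_iff₀ (sub_pos.2 htT₁)]; linarith [ht.1]
      have hXb' : 1 ≤ (T₁ / (T₁ - t)) ^ b' := Real.one_le_rpow hXt1 hb'0
      have hforce : (∫ r in (0 : ℝ)..t, Γ * σ ^ 3 *
          (1 + (Cpoly 0 * (T₁ - r) ^ (-ppoly 0)) ^ (1 / 3 : ℝ)) ^ 8 / (T₁ - r)) / 2 ≤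
          σ ^ 3 * Γ' * (T₁ / (T₁ - t)) ^ b' :=
        level0_forcing_integral_le hΓ hσ.le (hCpoly 0) hT₁ ht.1 htT₁
      have hk : Real.sqrt (shadowE0 ζ ρ θ u ρ₁ θ₁ u₁ t) ≤ (T₁ / (T₁ - t)) ^ (Λ / 2) *
          (Real.sqrt (shadowE0 ζ ρ θ u ρ₁ θ₁ u₁ 0) + (∫ r in (0 : ℝ)..t, Γ * σ ^ 3 *
            (1 + (Cpoly 0 * (T₁ - r) ^ (-ppoly 0)) ^ (1 / 3 : ℝ)) ^ 8 / (T₁ - r)) / 2) :=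
        key t ht
      calc Real.sqrt (shadowE0 ζ ρ θ u ρ₁ θ₁ u₁ t)
          ≤ (T₁ / (T₁ - t)) ^ (Λ / 2) * (σ ^ 3 * Qi + σ ^ 3 * Γ' * (T₁ / (T₁ - t)) ^ b') :=
            hk.trans (mul_le_mul_of_nonneg_left (add_le_add hinit hforce) (Real.rpow_nonneg hXt.le _))
        _ ≤ (T₁ / (T₁ - t)) ^ (Λ / 2) *
              (σ ^ 3 * Qi * (T₁ / (T₁ - t)) ^ b' + σ ^ 3 * Γ' * (T₁ / (T₁ - t)) ^ b') :=
            mul_le_mul_of_nonneg_left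
              (add_le_add (le_mul_of_one_le_right (mul_nonneg hσ3 hQi0) hXb') le_rfl)
              (Real.rpow_nonneg hXt.le _)
        _ = σ ^ 3 * (Qi + Γ') * (T₁ / (T₁ - t)) ^ (Λ / 2 + b') := by
            rw [Real.rpow_add hXt (Λ / 2) b']
            ring
    -- pass to the limit `t → s⁻`
    have hcont : ContinuousOn (shadowE0 ζ ρ θ u ρ₁ θ₁ u₁) (Ico 0 T) :=
      continuousOn_shadowE0_of_solutions hE hE₁ hJ hζ hρJ
    have hf : ContinuousWithinAt (fun t => Real.sqrt (shadowE0 ζ ρ θ u ρ₁ θ₁ u₁ t)) (Ico 0 s) s :=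
      (hcont.sqrt s ⟨hs.1, hsT⟩).mono hsub
    have hg : ContinuousWithinAt (fun t => σ ^ 3 * (Qi + Γ') * (T₁ / (T₁ - t)) ^ (Λ / 2 + b'))
        (Ico 0 s) s := by
      refine ContinuousAt.continuousWithinAt ?_
      refine continuousAt_const.mul (ContinuousAt.rpow_const ?_ (Or.inr (by positivity)))
      exact continuousAt_const.div (continuousAt_const.sub continuousAt_id) (sub_pos.2 hsT₁).ne'
    have hclos : s ∈ closure (Ico 0 s) := by
      rw [closure_Ico hs0.ne]
      exact right_mem_Icc.2 hs0.le
    exact ContinuousWithinAt.closure_le hclos hf hg hbound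

end Level0Contract

end Summit.AtomisticToContinuum.HydrodynamicLimit.Theorems

end
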